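import Mathlib
import Summits.NavierStokesRegularity.NavierStokesRegularity.Theorems.TaoLadderRungTwoFlatTruncatedHopTwoGauge
import Summits.NavierStokesRegularity.NavierStokesRegularity.Theorems.TaoLadderRungTwoFlatHopRenormalisation
import HarnessLib

/-!
# The localised, anchored hop estimate RE-NORMALISED: after one hop the core of the solution is within
  `ρB + (1+q)Rem + O((CB)²)` of an honest member `κ·Φ(·, τ + h)` of the pulse family (L5a landing form at λ₀ = 1)
  (helper for stmt-NavierStokesRegularity-23909 `GradedAdiabaticWake` / stmt-…-23908; route TaoLadderRungTwoFlat;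
  cell harvest/h2-tao-ladder, p1 g21; LADDER §49.5, §51, HopTube Landing forms)

From `MirrorPulse.truncated_hop_estimate_anchored` (phase coefficient `c₁`, anchored scale `ĉ₂ = anchorCoeff(η, c₁)`) and
p1 g20's second-order Taylor bound in the gauge (`QuadPolar.gauge_abs_taylor_le`): with `κ := 1 + ĉ₂`, `h := c₁/κ`,
  `ω_{i,k}·|X_{i,k+1}(τ) − κ·Φ_{i,k+1}(τ + h)| ≤ ρB + (1+q)·Rem + 12(C_a B)²·‖T♭‖₁²g²M_w³`   on the CORE (`k ≥ e`),
where `C_a B` bounds `|c₁|` and `|ĉ₂|` (`C_a B ≤ 1/2`), `M_w` is a head-gauge bound of the pulse near time `τ`, and at the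
anchor coordinate `X_{i₀,1}(τ) = κΦ_{i₀,1}(τ) + c₁Φ̇_{i₀,1}(τ)` holds EXACTLY (`anchorCoeff_spec`). This is the shape
`HopTube.coreClause_recentre` consumes up to the `O(h²)` re-anchoring at the shifted time (factor `1+q` again) — the phase
is carried by the template's time shift `h`; carrying it by the landing time of `X` instead is the same estimate with
`X`'s Taylor bound.

HONEST FRAMING: a conditional estimate about a MODEL lattice (Tao 2016 §4 vocabulary on `S♭`); the pulse, the anchored
(S2) and all bounds are HYPOTHESES; nothing certified; nothing about the Navier–Stokes equations.
-/

noncomputable section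

-- the sub-problem namespace repeats the summit name by design (D-0017)
set_option linter.dupNamespace false

namespace Summit.NavierStokesRegularity.NavierStokesRegularity.Theorems

open Set Filter Literature.Analysis.FluidPDE Literature.Analysis.FluidPDE.TaoCascade QuadPolar
open scoped Topology

namespace MirrorPulse

/-- **RE-NORMALISED LANDING OF THE ANCHORED HOP ESTIMATE.** Given the conclusion shape of
`truncated_hop_estimate_anchored` for some `c₁, ĉ₂` with `|c₁|, |ĉ₂| ≤ C_aB ≤ 1/2` (hypothesis `hest`), a pulse `Φ` that is
a global solution with head-gauge bound `M_w` on `[τ−1, τ+1]`, and `η = X − Φ` on the read-out sites: with `κ = 1 + ĉ₂`,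
`h = c₁/κ` (`|κ − 1| ≤ C_aB`, `|h| ≤ 2C_aB`),
`ω_{i,k}|X_{i,k+1}(τ) − κΦ_{i,k+1}(τ+h)| ≤ E + 12(C_aB)²(‖T♭‖₁²g²M_w³)` for every read-out site where `η = X − Φ`.
[cite: Tao2016AveragedNS, §4 (4.8), §6.3–6.4 (statement shape); route TaoLadderRungTwoFlat, L3/L5a landing (LADDER §49.5, §51)] -/
theorem anchored_landing {ε τ : ℝ} {Φ X η : Fin 2 → ℤ → ℝ → ℝ} {g b Mw E CaB c₁ c₂ : ℝ}
    (hΦ : IsGlobalSol ε Φ) (hg : 1 ≤ g) (hb : 1 ≤ b) (hMw : 0 ≤ Mw)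
    (hΦg : ∀ j k, ∀ t ∈ Icc (τ - 1) (τ + 1), headGauge g j k * |Φ j k t| ≤ Mw)
    (hc₁ : |c₁| ≤ CaB) (hc₂ : |c₂| ≤ CaB) (hCaB : CaB ≤ 1 / 2)
    (hest : ∀ (i : Fin 2) (k : ℤ), geomGauge g b i k *
      |η i (k + 1) τ - c₁ * quadTermOn shiftSetFlat 0 (mirrorTable ε ε) Φ i (k + 1) τ - c₂ * Φ i (k + 1) τ| ≤ E)
    (i : Fin 2) (k : ℤ) (hηX : η i (k + 1) τ = X i (k + 1) τ - Φ i (k + 1) τ) :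
    |(1 + c₂) - 1| ≤ CaB ∧ |c₁ / (1 + c₂)| ≤ 2 * CaB ∧
      geomGauge g b i k * |X i (k + 1) τ - (1 + c₂) * Φ i (k + 1) (τ + c₁ / (1 + c₂))| ≤
        E + 12 * CaB ^ 2 * ((tableAbsSum shiftSetFlat (mirrorTable ε ε)) ^ 2 * g ^ 2 * Mw ^ 3) := by
  set κ : ℝ := 1 + c₂ with hκ
  have hc₂' : |c₂| ≤ 1 / 2 := hc₂.trans hCaB
  have hκlo : 1 / 2 ≤ κ := by rw [hκ]; linarith [(abs_le.mp hc₂').1]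
  have hκhi : κ ≤ 3 / 2 := by rw [hκ]; linarith [(abs_le.mp hc₂').2]
  have hκpos : 0 < κ := by linarith
  set h : ℝ := c₁ / κ with hh
  have hCaB0 : 0 ≤ CaB := (abs_nonneg _).trans hc₁
  have hhabs : |h| ≤ 2 * CaB := by
    rw [hh, abs_div, abs_of_pos hκpos, div_le_iff₀ hκpos]
    nlinarith [hc₁, abs_nonneg c₁]
  have hh1 : |h| ≤ 1 := hhabs.trans (by linarith)
  refine ⟨by rw [hκ]; simpa using hc₂, hhabs, ?_⟩
  -- gauges
  have hwpos : ∀ j n, 0 < headGauge g j n := fun j n => headGauge_pos (by linarith) j n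
  have hA : IsWindowAdmissible (headGauge g) g := isWindowAdmissible_headGauge hg
  have hωw : geomGauge g b i k ≤ headGauge g i (k + 1) :=
    (geomGauge_le_succ hg hb i k).trans (geomGauge_le_headGauge (by linarith) hb i (k + 1))
  have hω0 : 0 ≤ geomGauge g b i k := (geomGauge_pos (by linarith) (by linarith) i k).le
  -- Taylor part on the pulse, head gauge at the read-out site, then dominated in ω
  set G : ℝ := (tableAbsSum shiftSetFlat (mirrorTable ε ε)) ^ 2 * g ^ 2 * Mw ^ 3 with hG
  have hG0 : 0 ≤ G := by rw [hG]; positivity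
  have htay := gauge_abs_taylor_le isNearestNeighbourSet_shiftSetFlat (mirrorTable ε ε) hwpos hA hMw hΦ hΦg hh1
    i (k + 1)
  have h2 : geomGauge g b i k * |κ * (Φ i (k + 1) (τ + h) - Φ i (k + 1) τ
      - h * quadTermOn shiftSetFlat 0 (mirrorTable ε ε) Φ i (k + 1) τ)| ≤ 12 * CaB ^ 2 * G := by
    rw [abs_mul, abs_of_pos hκpos]
    have hh2 : h ^ 2 ≤ (2 * CaB) ^ 2 := by
      rw [← sq_abs]; exact pow_le_pow_left₀ (abs_nonneg _) hhabs 2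
    calc geomGauge g b i k * (κ * |Φ i (k + 1) (τ + h) - Φ i (k + 1) τ
            - h * quadTermOn shiftSetFlat 0 (mirrorTable ε ε) Φ i (k + 1) τ|)
        ≤ headGauge g i (k + 1) * (κ * |Φ i (k + 1) (τ + h) - Φ i (k + 1) τ
            - h * quadTermOn shiftSetFlat 0 (mirrorTable ε ε) Φ i (k + 1) τ|) :=
          mul_le_mul_of_nonneg_right hωw (by positivity)
      _ = κ * (headGauge g i (k + 1) * |Φ i (k + 1) (τ + h) - Φ i (k + 1) τ
            - h * quadTermOn shiftSetFlat 0 (mirrorTable ε ε) Φ i (k + 1) τ|) := by ring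
      _ ≤ κ * (2 * G * h ^ 2) := by
          refine mul_le_mul_of_nonneg_left ?_ hκpos.le
          calc _ ≤ 2 * (tableAbsSum shiftSetFlat (mirrorTable ε ε)) ^ 2 * g ^ 2 * Mw ^ 3 * h ^ 2 := htay
            _ = 2 * G * h ^ 2 := by rw [hG]; ring
      _ ≤ 3 / 2 * (2 * G * (2 * CaB) ^ 2) := by
          have h0 : 0 ≤ 2 * G * h ^ 2 := by positivity
          have h3 : 2 * G * h ^ 2 ≤ 2 * G * (2 * CaB) ^ 2 := mul_le_mul_of_nonneg_left hh2 (by positivity)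
          calc κ * (2 * G * h ^ 2) ≤ 3 / 2 * (2 * G * h ^ 2) := mul_le_mul_of_nonneg_right hκhi h0
            _ ≤ 3 / 2 * (2 * G * (2 * CaB) ^ 2) := mul_le_mul_of_nonneg_left h3 (by norm_num)
      _ = 12 * CaB ^ 2 * G := by ring
  -- algebra: X − κΦ(τ+h) = [η − c₁Φ̇ − c₂Φ] − κ[Φ(τ+h) − Φ(τ) − hΦ̇(τ)]
  have hκh : κ * h = c₁ := by rw [hh]; field_simp
  have e : X i (k + 1) τ - κ * Φ i (k + 1) (τ + h) =
      (η i (k + 1) τ - c₁ * quadTermOn shiftSetFlat 0 (mirrorTable ε ε) Φ i (k + 1) τ - c₂ * Φ i (k + 1) τ) -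
        κ * (Φ i (k + 1) (τ + h) - Φ i (k + 1) τ - h * quadTermOn shiftSetFlat 0 (mirrorTable ε ε) Φ i (k + 1) τ) := by
    rw [hηX]
    linear_combination (-(Φ i (k + 1) τ)) * hκ + (-(quadTermOn shiftSetFlat 0 (mirrorTable ε ε) Φ i (k + 1) τ)) * hκh
  rw [e]
  have h1 := hest i k
  calc geomGauge g b i k * |(η i (k + 1) τ - c₁ * quadTermOn shiftSetFlat 0 (mirrorTable ε ε) Φ i (k + 1) τ
            - c₂ * Φ i (k + 1) τ)
          - κ * (Φ i (k + 1) (τ + h) - Φ i (k + 1) τ - h * quadTermOn shiftSetFlat 0 (mirrorTable ε ε) Φ i (k + 1) τ)|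
      ≤ geomGauge g b i k * (|η i (k + 1) τ - c₁ * quadTermOn shiftSetFlat 0 (mirrorTable ε ε) Φ i (k + 1) τ
            - c₂ * Φ i (k + 1) τ|
          + |κ * (Φ i (k + 1) (τ + h) - Φ i (k + 1) τ - h * quadTermOn shiftSetFlat 0 (mirrorTable ε ε) Φ i (k + 1) τ)|) :=
        mul_le_mul_of_nonneg_left (abs_sub _ _) hω0
    _ ≤ E + 12 * CaB ^ 2 * G := by nlinarith [h1, h2, hω0]

/-- On the core the truncated deviation IS `X − Φ`: `truncFam e (X − Φ) i (k+1) τ = X_{i,k+1}(τ) − Φ_{i,k+1}(τ)` for `k ≥ e`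
(the read-out hypothesis `hηX` of `anchored_landing`). [cite: Tao2016AveragedNS, §4 (4.8); route TaoLadderRungTwoFlat, L8b-3] -/
theorem truncFam_sub_readout {e k : ℤ} (hk : e ≤ k) (X Φ : Fin 2 → ℤ → ℝ → ℝ) (i : Fin 2) (τ : ℝ) :
    truncFam e (X - Φ) i (k + 1) τ = X i (k + 1) τ - Φ i (k + 1) τ := by
  have h : e + 1 ≤ k + 1 := by omega
  simp [truncFam, h]

end MirrorPulse

end Summit.NavierStokesRegularity.NavierStokesRegularity.Theorems

end
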